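import Literature.Topology.FourManifolds.ThetaFourKervaireMilnorSurgeryProofs
import Literature.Topology.FourManifolds.SphereSurgeryOddMiddleHomology
import Literature.Topology.FourManifolds.SphereCorePrimitive
import HarnessLib

/-!
# `Θ₄ = 0` along Kervaire–Milnor's proof, III: Lemma 5.6, the Assertion of p. 516 and the duality
# step of Lemma 5.7 discharged in the reduction of Theorem 5.1 at `k = 2`

Topic `Literature/Topology/FourManifolds`; third proofs file of `ThetaFourKervaireMilnor.lean`
(after `ThetaFourKervaireMilnorProofs.lean` and `ThetaFourKervaireMilnorSurgeryProofs.lean`),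
written by the fact seat of the named fact
`Literature.Topology.FourManifolds.HomotopySphere.boundsContractible_of_nullCobordism_isStablyParallelizable_four`
— M. Kervaire, J. Milnor, *Groups of homotopy spheres I*, Ann. of Math. (2) 77 (1963),
**Thm. 5.1** (p. 512) at `k = 2`. Everything here is **proved**; no definition, no named fact and
no statement of the tree is added or changed (D-0026).

`ThetaFourKervaireMilnorSurgeryProofs.lean` reduced the fact along the printed proof (§5) to five
inline hypotheses about one spherical modification `χ(W, φ) = c.surgery ν rfl` of a null-cobordism
`W` of the homotopy `4`-sphere along a framed `2`-sphere
(`HomotopySphere.boundsContractible_of_nullCobordism_isStablyParallelizable_four_of_surgeryLemmas`):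
`h55` (Thm. 5.5), `h534` (Lemmas 5.3–5.4 with Hurewicz), `h56` (Lemma 5.6), `hkill` (the Assertion
of p. 516 with the duality step of the proof of Lemma 5.7) and `h58` (Lemma 5.8). Three of these
sentences are now theorems of the tree:

* **Lemma 5.6** (pp. 514–516: "the quotient group `HₖM/λ(Z)` is isomorphic to `HₖM'/λ'(Z)`"), for
  the tree's surgery in the middle dimension of an odd-dimensional manifold, is
  `FramedSphereFamily.nonempty_quotient_addEquiv_quotient_surgered`
  (`SphereSurgeryOddMiddleHomology.lean`), so `h56` is DISCHARGED;
* the **Assertion** of p. 516 ("Any primitive element of `HₖM` can be killed by a spherical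
  modification": `HₖM' ≅ HₖM/λ(Z)`) is
  `FramedSphereFamily.nonempty_addEquiv_quotient_surgered_of_epi` (same file) GIVEN the primitivity
  of `λ` in its homological form — `Hₖ₊₁M → Hₖ₊₁(M, M₀) ≅ Z`, `μ ↦ μ·λ`, is onto (diagram p. 515);
* that primitivity, for a class generating an infinite cyclic direct summand, is the duality
  sentence of the proof of **Lemma 5.7** (p. 516: "Using the Poincaré duality theorem one sees that
  `μ₁·λ = 1` for some element `μ₁ ∈ Hₖ₊₁(M, bM)`. But the exact sequence
  `Hₖ₊₁M → Hₖ₊₁(M, bM) → Hₖ(bM) = 0` shows that `μ₁` can be lifted back to `Hₖ₊₁M`. Therefore `λ`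
  is primitive"), which is the tree's `NullCobordism.epi_ofAbsolute_complement_of_exists_dual`
  (`SphereCorePrimitive.lean`: Lefschetz duality, universal coefficients and Čech–Alexander duality
  along the core sphere); so `hkill` is DISCHARGED.

* `HomotopySphere.boundsContractible_of_nullCobordism_isStablyParallelizable_four_of_surgeryLemmas_homological`
  — the named fact GIVEN `h55`, `h534`, `h58` only.

So the frontier of `boundsContractible_of_nullCobordism_isStablyParallelizable_four_holds` is now:
Thm. 5.5 at `n = 5` (`h55`: 1-dimensional framed modifications killing `π₁`), Lemmas 5.3–5.4 at
`p = 2`, `n = 5` (`h534`: framed imbedded `2`-spheres with s-parallelizable modification), and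
Lemma 5.8 at `k = 2` (`h58`: the modification changes the second Betti number).

## References

* M. Kervaire, J. Milnor, *Groups of homotopy spheres I*, Ann. of Math. (2) 77 (1963), 504–537:
  Thm. 5.1 (p. 512), Lemma 5.6 (pp. 514–516), Assertion and Lemma 5.7 (p. 516), Lemma 5.8
  (pp. 516–518), proof of Thm. 5.1 for `k` even (pp. 518–519). doi:10.2307/1970128
  [KervaireMilnorAnnals1963]
-/

noncomputable section

open scoped Manifold ContDiff Topology
open Set Function CategoryTheory CategoryTheory.Limits AddSubgroup
open Literature.AlgebraicTopology.SingularHomology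

namespace Literature.Topology.FourManifolds

namespace HomotopySphere

/-- **Kervaire–Milnor's Thm. 5.1 at `k = 2` along its printed proof (§5), with Lemma 5.6, the
Assertion of p. 516 and the duality step of Lemma 5.7 discharged.** The named fact
`boundsContractible_of_nullCobordism_isStablyParallelizable_four` (every homotopy `4`-sphere
bounding a compact s-parallelizable `5`-manifold bounds a contractible one) GIVEN, as inline
hypotheses about null-cobordisms `W` (`c`, `bW = Σ`) of the homotopy `4`-sphere `Σ` and the tree's
surgery `χ(W, φ) = c.surgery ν rfl` along a framed imbedded `2`-sphere
`φ = ν : FramedSphereFamily (𝓡∂ 5) W Unit 2 3`: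
* `h55` — **Thm. 5.5** (p. 514) at `n = 5`, `k = 2` (a compact connected s-parallelizable `W`
  becomes simply connected and stays s-parallelizable by spherical modifications, `bW₁ = bW`);
* `h534` — **Lemmas 5.3 and 5.4** (pp. 513–514) read on `H₂` through Hurewicz: for `W` simply
  connected and s-parallelizable, every class of `H₂(W; ℤ)` is the class `φ_*[S²]` of a framed
  imbedded `2`-sphere `φ` with `χ(W, φ)` again s-parallelizable;
* `h58` — **Lemma 5.8** (p. 516) at `k = 2`: the modification changes the second Betti number.
PROVED (besides everything already proved in `…_of_surgeryLemmas`): **Lemma 5.6**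
(`FramedSphereFamily.nonempty_quotient_addEquiv_quotient_surgered`: `H₂W/λ(Z) ≅ H₂χ/λ'(Z)`, `λ'`
the class of the core `φ'(0 × S²)` of the handle), the **Assertion** of p. 516 from primitivity
(`FramedSphereFamily.nonempty_addEquiv_quotient_surgered_of_epi`: `H₂χ ≅ H₂W/λ(Z)`), and the
duality step of **Lemma 5.7** (`NullCobordism.epi_ofAbsolute_complement_of_exists_dual`: a class
`λ` with `f λ = 1` for some `f : H₂W → Z` is primitive, `H₃(W) → H₃(W, W ∖ φ(S² × 0))` is onto).
[cite: KervaireMilnorAnnals1963, Thm. 5.1 (p. 512) via Thm. 5.5 (p. 514), Lemmas 5.3, 5.4, 5.6, 5.7, 5.8 (pp. 513–518) and pp. 518–519] -/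
theorem boundsContractible_of_nullCobordism_isStablyParallelizable_four_of_surgeryLemmas_homological
    (h55 : ∀ (S : HomotopySphere 4) (c : NullCobordism 4 S.carrier), ConnectedSpace c.W →
      IsStablyParallelizable (𝓡∂ (4 + 1)) c.W →
        ∃ c₁ : NullCobordism 4 S.carrier,
          SimplyConnectedSpace c₁.W ∧ IsStablyParallelizable (𝓡∂ (4 + 1)) c₁.W)
    (h534 : ∀ (S : HomotopySphere 4) (c : NullCobordism 4 S.carrier), SimplyConnectedSpace c.W →
      IsStablyParallelizable (𝓡∂ (4 + 1)) c.W → ∀ x : singularHomology ℤ ℤ c.W 2,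
        ∃ (ν : FramedSphereFamily (𝓡∂ (4 + 1)) c.W Unit 2 (2 + 1))
          (θ : singularHomology ℤ ℤ (Metric.sphere (0 : EuclideanSpace ℝ (Fin (2 + 1))) 1) 2),
          zmultiples θ = ⊤ ∧ singularHomology.map ℤ ℤ ν.sphereMap 2 θ = x ∧
            IsStablyParallelizable (𝓡∂ (4 + 1)) (c.surgery ν rfl).W)
    (h58 : ∀ (S : HomotopySphere 4) (c : NullCobordism 4 S.carrier), SimplyConnectedSpace c.W →
      IsStablyParallelizable (𝓡∂ (4 + 1)) c.W →
        ∀ ν : FramedSphereFamily (𝓡∂ (4 + 1)) c.W Unit 2 (2 + 1),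
          Module.finrank ℤ (singularHomology ℤ ℤ (c.surgery ν rfl).W 2) ≠
            Module.finrank ℤ (singularHomology ℤ ℤ c.W 2)) :
    boundsContractible_of_nullCobordism_isStablyParallelizable_four :=
  boundsContractible_of_nullCobordism_isStablyParallelizable_four_of_surgeryLemmas h55 h534
    (fun _ c _ _ ν _ hθ =>
      ⟨_, FramedSphereFamily.nonempty_quotient_addEquiv_quotient_surgered (X := c.W) ν rfl le_rfl
        hθ⟩)
    (fun S c hsc _ ν θ hθ hf => by
      haveI := hsc
      exact FramedSphereFamily.nonempty_addEquiv_quotient_surgered_of_epi (X := c.W) ν rfl le_rfl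
        hθ (NullCobordism.epi_ofAbsolute_complement_of_exists_dual S c ν rfl le_rfl two_ne_zero
          (by norm_num) hθ hf))
    h58

end HomotopySphere

end Literature.Topology.FourManifolds

end
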